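import Summits.CriticalPhenomena.PercolationContinuityZ3.Theorems.SahiMasterFamilyBottomDivisibility

/-!
# The inductive step of the rare-corner programme at a uniform peeling slot

Unit `prim-master-conj` (crux anchor stmt-CriticalPhenomena-4575), gen 8; paper BOTTOM-COEFFICIENT.md §7.4.  Write `G(U)` for the bottom
coefficient `[∏_e X_e] E_k(U)` (`coeff (blockProfile univ) (sahiEPoly k (ind ∘ U))`).  Conjecture (B')_k says: if every `0`-minor of `U` is a
zero flag then `G(U) ≥ 0`, with `G(U) ≥ 1` unless `U` itself is a zero flag.  This file proves the INDUCTIVE STEP of the programme on the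
families that have a UNIFORM peeling slot `i` (the deleted family `U_{−i}` and every modified family `U_{−i}[l ↦ U_l ∩ U_i]` have all their
`0`-minors in `Z_{k−1}`):

* `bottomCoeff_nonneg_of_uniform` — (B')_{k−1} (non-negativity half, as a hypothesis on this `ι`) ⟹ `G(U) ≥ 0`;
* `one_le_bottomCoeff_of_uniform` — (B')_{k−1} (both halves) and REDUNDANCY_k (`Z(U_{−i}[l ↦ U_l ∩ U_i])` for all `l` ⟹ `Z(U_{−i})`; order 3 is
  the tree's `suppZeroFlag_three_of_inter`) as hypotheses ⟹ `G(U) ≥ 1` for every such `U` that is not a zero flag;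
* `bottomCoeff_le_of_uniform` — the upper bound `G(U) ≤ (k−1)·M` from a bound `M` one order down (so `G ≤ (k−1)!` inductively).
The engine is `bottomCoeff_peel_of_uniform` (`G(U) = Σ_l G(U_{−i}[l ↦ U_l ∩ U_i])`).  With `SahiMasterFamilyBottomCoeff`
(`masterFamilyIdentEqIff_of_bottomCoeff_all`) this reduces (EQI-k) to (B')_{k−1}, REDUNDANCY_k and the families WITHOUT a uniform slot (the
"cored" families of the paper, §8).  No conjecture is asserted; axioms standard. [this work]
-/

noncomputable section

open scoped Classical

namespace Summit.CriticalPhenomena.PercolationContinuityZ3.Theorems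

open Finset Function MvPolynomial
open Literature.Computability.AlgebraicComplexity (blockProfile)
open Literature.Combinatorics.Sahi2008
open Literature.Probability.Percolation.DecisionTree (ind)

variable {ι : Type} [Fintype ι]

/-- A zero flag has bottom coefficient `0`. [this work] -/
theorem bottomCoeff_eq_zero_of_suppZeroFlag {k : ℕ} {U : Fin k → Set (Set ι)} (hU : SuppZeroFlag k U) (S : Finset ι) :
    coeff (blockProfile S) (sahiEPoly k fun j => ind (U j)) = 0 := by
  rw [sahiEPoly_eq_zero_of_suppZeroFlag hU, coeff_zero]

/-- **Non-negativity at a uniform slot from non-negativity one order down.** [this work] -/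
theorem bottomCoeff_nonneg_of_uniform {n : ℕ} (U : Fin (n + 2) → Set (Set ι)) (i : Fin (n + 2)) (hUi : ∅ ∉ U i)
    (hU0 : ∀ e, SuppZeroFlag (n + 1) (fun j => secAt e false (U (i.succAbove j))))
    (hV0 : ∀ (l : Fin (n + 1)) (e : ι), SuppZeroFlag (n + 1)
      (fun j => secAt e false (update (fun j => U (i.succAbove j)) l (U (i.succAbove l) ∩ U i) j)))
    (hB : ∀ W : Fin (n + 1) → Set (Set ι), (∀ e, SuppZeroFlag (n + 1) (fun j => secAt e false (W j))) →
      0 ≤ coeff (blockProfile (univ : Finset ι)) (sahiEPoly (n + 1) fun j => ind (W j))) :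
    0 ≤ coeff (blockProfile (univ : Finset ι)) (sahiEPoly (n + 2) fun j => ind (U j)) := by
  rw [bottomCoeff_peel_of_uniform U i hUi hU0]
  exact Finset.sum_nonneg fun l _ => hB _ (hV0 l)

/-- **The inductive step (B')_{k−1} ∧ REDUNDANCY_k ⟹ (B')_k on families with a uniform peeling slot** (`k = n + 3`).  Hypotheses: `∅ ∉ U_i`;
`i` is a uniform peeling slot (every `0`-minor of `U_{−i}` and of each `U_{−i}[l ↦ U_l ∩ U_i]` is a zero flag); (B')_{n+2} on this `ι`
(0-vanishing families have bottom coefficient `≥ 0`, and `≥ 1` unless they are zero flags); REDUNDANCY at slot `i`; `U ∉ Z_{n+3}`.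
Conclusion: `[∏_e X_e] E_{n+3}(U) ≥ 1`. [this work] -/
theorem one_le_bottomCoeff_of_uniform {n : ℕ} (U : Fin (n + 3) → Set (Set ι)) (i : Fin (n + 3)) (hUi : ∅ ∉ U i)
    (hU0 : ∀ e, SuppZeroFlag (n + 2) (fun j => secAt e false (U (i.succAbove j))))
    (hV0 : ∀ (l : Fin (n + 2)) (e : ι), SuppZeroFlag (n + 2)
      (fun j => secAt e false (update (fun j => U (i.succAbove j)) l (U (i.succAbove l) ∩ U i) j)))
    (hB : ∀ W : Fin (n + 2) → Set (Set ι), (∀ e, SuppZeroFlag (n + 2) (fun j => secAt e false (W j))) →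
      0 ≤ coeff (blockProfile (univ : Finset ι)) (sahiEPoly (n + 2) fun j => ind (W j)) ∧
        (¬ SuppZeroFlag (n + 2) W → 1 ≤ coeff (blockProfile (univ : Finset ι)) (sahiEPoly (n + 2) fun j => ind (W j))))
    (hR : (∀ l : Fin (n + 2), SuppZeroFlag (n + 2) (update (fun j => U (i.succAbove j)) l (U (i.succAbove l) ∩ U i))) →
      SuppZeroFlag (n + 2) (fun j => U (i.succAbove j)))
    (hZ : ¬ SuppZeroFlag (n + 3) U) :
    1 ≤ coeff (blockProfile (univ : Finset ι)) (sahiEPoly (n + 3) fun j => ind (U j)) := by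
  rw [bottomCoeff_peel_of_uniform U i hUi hU0]
  -- some modified family is not a zero flag (else `U` would be one, by redundancy and the definition of `Z`)
  have hex : ∃ l : Fin (n + 2), ¬ SuppZeroFlag (n + 2) (update (fun j => U (i.succAbove j)) l (U (i.succAbove l) ∩ U i)) := by
    by_contra hall
    push Not at hall
    exact hZ ⟨i, hR hall, hall⟩
  obtain ⟨l₀, hl₀⟩ := hex
  have hterm : ∀ l : Fin (n + 2), 0 ≤ coeff (blockProfile (univ : Finset ι))
      (sahiEPoly (n + 2) fun j => ind (update (fun j => U (i.succAbove j)) l (U (i.succAbove l) ∩ U i) j)) :=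
    fun l => (hB _ (hV0 l)).1
  calc (1 : ℝ) ≤ coeff (blockProfile (univ : Finset ι))
        (sahiEPoly (n + 2) fun j => ind (update (fun j => U (i.succAbove j)) l₀ (U (i.succAbove l₀) ∩ U i) j)) :=
        (hB _ (hV0 l₀)).2 hl₀
    _ ≤ ∑ l : Fin (n + 2), coeff (blockProfile (univ : Finset ι))
        (sahiEPoly (n + 2) fun j => ind (update (fun j => U (i.succAbove j)) l (U (i.succAbove l) ∩ U i) j)) :=
        Finset.single_le_sum (fun l _ => hterm l) (Finset.mem_univ l₀)

/-- **The upper bound at a uniform slot**: if every 0-vanishing family one order down has bottom coefficient `≤ M`, then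
`[∏X_e] E_{n+2}(U) ≤ (n+1)·M` (inductively `≤ (k−1)!`). [this work] -/
theorem bottomCoeff_le_of_uniform {n : ℕ} (U : Fin (n + 2) → Set (Set ι)) (i : Fin (n + 2)) (hUi : ∅ ∉ U i) (M : ℝ)
    (hU0 : ∀ e, SuppZeroFlag (n + 1) (fun j => secAt e false (U (i.succAbove j))))
    (hV0 : ∀ (l : Fin (n + 1)) (e : ι), SuppZeroFlag (n + 1)
      (fun j => secAt e false (update (fun j => U (i.succAbove j)) l (U (i.succAbove l) ∩ U i) j)))
    (hB : ∀ W : Fin (n + 1) → Set (Set ι), (∀ e, SuppZeroFlag (n + 1) (fun j => secAt e false (W j))) →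
      coeff (blockProfile (univ : Finset ι)) (sahiEPoly (n + 1) fun j => ind (W j)) ≤ M) :
    coeff (blockProfile (univ : Finset ι)) (sahiEPoly (n + 2) fun j => ind (U j)) ≤ (n + 1) * M := by
  rw [bottomCoeff_peel_of_uniform U i hUi hU0]
  calc ∑ l : Fin (n + 1), coeff (blockProfile (univ : Finset ι))
        (sahiEPoly (n + 1) fun j => ind (update (fun j => U (i.succAbove j)) l (U (i.succAbove l) ∩ U i) j))
      ≤ ∑ _l : Fin (n + 1), M := Finset.sum_le_sum fun l _ => hB _ (hV0 l)
    _ = (n + 1) * M := by rw [Finset.sum_const, Finset.card_univ, Fintype.card_fin, nsmul_eq_mul]; push_cast; ring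

end Summit.CriticalPhenomena.PercolationContinuityZ3.Theorems
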